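/-
Copyright (c) 2026. All rights reserved.
Released under Apache 2.0 license as described in the file LICENSE.
Authors: abc-iut cell, prover seat abc-iut-w5-d096 (gen 8; row «PUNCTURED-HIGHER-GENUS-IDRIGID» of the
[AbsTopIII] Prop 4.2 (i) / Cor 4.5 geometric column — the final assembly at GENUINE punctured hyperbolic
Riemann surfaces over the cusp data, consumer of abc-iut-L4-t14's `hfin`-free column, abc-iut-L4-d1's
cusped normaliser finiteness, abc-iut-w6-d031's uniformised-base junction and puncture-is-cusp theorem,
and this seat's unconditional uniformisation `HyperbolicRiemannSurfaceUniformizationUnconditional`).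
-/
import Literature.AnabelianGeometry.AbsoluteAnabelian.ArchimedeanHolFieldFunctorGeometricPSLCor45Full
import Literature.AnabelianGeometry.AbsoluteAnabelian.ArchimedeanHolFieldFunctorGeometricPSLHfinFree
import Literature.AnabelianGeometry.AbsoluteAnabelian.ArchimedeanHolFieldFunctorGeometricPSLCuspParabolicPuncture
import Literature.AnabelianGeometry.AbsoluteAnabelian.HyperbolicRiemannSurfaceUniformizationUnconditional
import HarnessLib

/-!
# [AbsTopIII] Prop 4.2 (i) / Cor 4.5 at GENUINE punctured hyperbolic Riemann surfaces, over the cusp data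
# of the Möbius deck group (PROOF-ONLY)

S. Mochizuki, *Topics in Absolute Anabelian Geometry III*, proof of Prop 4.2 (i), kurims p.106 l.11–19
(«for any object `X` of `EA`, the full subcategory of `EA` consisting of objects that map to `X` may … be
identified with the category of finite étale R-localizations `Loc_R(X)` …; thus, the id-rigidity of `EA`
follows immediately from the slimness assertion of Lemma 4.3»), Cor 4.5 pp.107–109 (kurims manuscript
`paper:url-5493eb38cbb7`; bib key `MochizukiAbsTopIII2015`).

State of the geometric column before this file.  abc-iut-L4-t10's
`HolRS.isIdRigid_EA_and_cor_4_5_full_mapsTo_of_cover_of_isOrientableSurfaceGroup` closes the COMPACT cell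
(genus `≥ 2`, `π₁` an orientable surface group) with no residual hypothesis; the genus-`0` and genus-`1`
punctured cells are closed by the (H1′)/(OUT) routes (`planeComplFinite_twist_eq_id`,
`torusMinusFinite_outer`).  For a PUNCTURED surface whose Möbius deck group `Λ̄` is free (every
non-compact finite-type hyperbolic surface), abc-iut-L4-t14's `hfin`-free column
(`isIdRigid_EA_mapsTo_pslQuotient_of_isFreeOrSurface_hfinFree`) needs exactly
`hN : [N_{PSL₂(ℝ)}(Λ̄′) : Λ̄′] < ∞` for every finite-index `Λ̄′ ≤ Λ̄`, which abc-iut-L4-d1 derives from the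
cusp data (P) «`Λ̄` contains a parabolic» + (FC) «finitely many `Λ̄`-classes of cusps»
(`LocObj.finiteIndex_subgroupOf_normalizer_of_cusps`); abc-iut-w6-d031 proved (P) for every uniformising
covering of every `M ∖ S` (`exists_parabolic_mem_of_cover_ofOpens_compl_finite`); and
`HolRS.exists_pslQuotient_iso_of_nonabelian_fundamentalGroup_unconditional` (this seat) makes the
uniformisation `X ≅ ℍ/Λ̄`, `Λ̄ ≃* π₁(X)`, unconditional for non-abelian `π₁`.  This file ASSEMBLES:

* `HolRS.isIdRigid_EA_and_cor_4_5_full_mapsTo_of_cover_of_hN` — for `X ∈ HolRS` with a holomorphic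
  covering `k : ℍ → X`, `π₁(X, x₀)` free of finite rank or an orientable surface group and non-abelian,
  and `hN` for the Möbius deck group of `k` (singled out by its membership criterion): the geometric `EA`
  of «objects of `HolRS` mapping to `X`» is ID-RIGID and `Cor_4_5_full` holds for its archimedean
  log-Frobenius data (the finite-covolume route feeds this form);
* `HolRS.isIdRigid_EA_and_cor_4_5_full_mapsTo_of_cover_of_cusps` — the same from (P)+(FC) for the deck
  group of `k`;
* `HolRS.isIdRigid_EA_and_cor_4_5_full_mapsTo_of_isFreeOrSurface_fundamentalGroup_of_cusps` — no covering
  given: `X` second countable, `π₁` free-or-surface and non-abelian, (P)+(FC) for the deck group of every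
  holomorphic covering `ℍ → X`;
* ★ `HolRS.isIdRigid_EA_and_cor_4_5_full_ofOpens_compl_finite_of_cuspClasses` — at the GENUINE punctured
  surface `M ∖ S` (`M` any second-countable Riemann surface, `S` finite non-empty, `M ∖ S` connected), (P) is
  DISCHARGED by abc-iut-w6-d031's theorem, so the hypotheses are: `π₁(M ∖ S)` free-or-surface and
  non-abelian, and (FC) for the deck group of every uniformising covering — after the (FC) closer of row
  «FC-ROUTE» the punctured cell closes modulo the topological input «`π₁` free of finite rank» alone;
* ★★ `HolRS.isIdRigid_EA_and_cor_4_5_full_mapsTo_of_isOfFiniteType_of_cuspClasses` — the same at EVERY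
  NON-COMPACT connected second-countable Riemann surface OF FINITE TYPE (`IsOfFiniteType`, the standing
  hypothesis of [AbsTopIII] Cor 2.4): the biholomorphism `X ≅ X̄ ∖ S` of the witness transports the
  uniformising covering, so (P) is discharged for abstract `X` too
  (`HolRS.exists_parabolic_mem_of_cover_of_isOfFiniteType` — (P) at every non-compact finite-type `X`).

Everything is a theorem; no definition, no instance, no named fact, no new hypothesis shape ((P), (FC), `hN`
are quoted VERBATIM from `…PSLHfinFree` / `…PSLCusped`, quantified over the Möbius deck group through its
membership criterion exactly as in abc-iut-w6-d031's (P) theorem).  THE TWO INPUTS THAT REMAIN, honestly: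
(α) `hπ : IsFreeOrSurface (π₁(X, x₀))` — for a punctured surface of genus `g ≥ 2` the freeness of `π₁` (rank
`2g + r − 1`) is a topological INPUT here, exactly like the compact column's `IsOrientableSurfaceGroup` (the
tree computes `π₁` only for `g ≤ 1`: `ℂ ∖ F`, torus minus a finite set); (β) `hFC` — the cusp-class
finiteness of the deck group, to be CONSUMED BY NAME from abc-iut-w6-d031's row «FC-ROUTE» theorem when it
lands (until then a binder; its statement is not restated here).  HONEST FRAMING: classical; MODEL side of
[AbsTopIII] §4 (model ≠ reconstruction ≠ node; NODES `AbsTopIII:Prop4.2(i)` / `AbsTopIII:Cor4.5` geometric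
column, support library); nothing in this file bears on the disputed [IUTchIII] Cor. 3.12.

## References

* S. Mochizuki, *Topics in Absolute Anabelian Geometry III* (2015), proof of Prop. 4.2 (i) p.106,
  Cor. 4.5 pp.107–109. [MochizukiAbsTopIII2015]
* H. M. Farkas, I. Kra, *Riemann Surfaces*, 2nd ed. (1992), IV.5.5–IV.5.6, IV.6. [FarkasKra1992]
* G. Shimura, *Introduction to the Arithmetic Theory of Automorphic Functions* (1971), §1.5. [Shimura1971]
-/

set_option autoImplicit false

noncomputable section

namespace Literature.AnabelianGeometry.AbsoluteAnabelian

namespace HolRS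

open scoped _root_.Manifold _root_.ContDiff _root_.Topology UpperHalfPlane MatrixGroups Matrix
open _root_.MulAction _root_.Function _root_.CategoryTheory _root_.TopologicalSpace
open Literature.IUT.HodgeTheaters (IsFreeOrSurface)

/-! ### §1 A given holomorphic covering `k : ℍ → X` -/

section Cover

variable (X : HolRS)

/-- **Prop 4.2 (i) id-rigidity and `Cor_4_5_full` at a genuine `X` from `hN` for the Möbius deck group.**
For `X ∈ HolRS`, a holomorphic covering map `k : ℍ → X`, `π₁(X, x₀)` free of finite rank or an orientable
surface group and non-abelian, and — for the Möbius deck group `Λ̄` of `k` (the subgroup of `PSL₂(ℝ)` with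
`q ∈ Λ̄ ↔ ∀ τ, k (q • τ) = k τ`) — `[N_{PSL₂(ℝ)}(Λ̄′) : Λ̄′] < ∞` for every finite-index `Λ̄′ ≤ Λ̄`: the
geometric `EA` of «objects of `HolRS` mapping to `X`» is id-rigid and every printed clause of Cor 4.5 holds
for its archimedean log-Frobenius data.  (abc-iut-w6-d031's junction `exists_pslQuotient_iso_of_cover_transport`;
abc-iut-L4-t14's `hfin`-free column at `ℍ/Λ̄`; transport along «maps to `ℍ/Λ̄`» = «maps to `X`».)
[cite: MochizukiAbsTopIII2015, Proposition 4.2 (i) proof p.106]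
[cite: MochizukiAbsTopIII2015, Corollary 4.5 pp.107–109] [cite: FarkasKra1992, IV.5.5–IV.5.6] -/
theorem isIdRigid_EA_and_cor_4_5_full_mapsTo_of_cover_of_hN {k : ℍ → X.carrier} (hk : IsCoveringMap k)
    (dk : MDifferentiable 𝓘(ℂ, ℂ) 𝓘(ℂ, ℂ) k) (x₀ : X.carrier)
    (hπ : IsFreeOrSurface (FundamentalGroup X.carrier x₀))
    (hab : ∃ a b : FundamentalGroup X.carrier x₀, a * b ≠ b * a)
    (hN : ∀ Λ : Subgroup PSL2R, (∀ q : PSL2R, q ∈ Λ ↔ ∀ τ : ℍ, k (q • τ) = k τ) →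
      ∀ Λ' : _root_.Literature.AnabelianGeometry.AbsoluteAnabelian.LocObj Λ,
        (Λ'.toSubgroup.subgroupOf (Subgroup.normalizer (Λ'.toSubgroup : Set PSL2R))).FiniteIndex) :
    IsIdRigid (geometricAutHolFieldFunctor fun Y : HolRS => Nonempty (Y ⟶ X)).EA ∧
      AbsTopIII.Cor_4_5_full
        (archLogFrobeniusData (geometricAutHolFieldFunctor fun Y : HolRS => Nonempty (Y ⟶ X)))
        (archTelecoreData (geometricAutHolFieldFunctor fun Y : HolRS => Nonempty (Y ⟶ X))) := by
  obtain ⟨Λ, hPD, hC, hΛ, hπΛ, -, hH, -⟩ := exists_pslQuotient_iso_of_cover_transport X hk dk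
  -- the Möbius deck group is free-or-surface and non-abelian
  obtain ⟨φ⟩ := hπΛ x₀
  have hΓ : IsFreeOrSurface Λ := IsFreeOrSurface.of_mulEquiv φ.symm hπ
  have habΛ : ∃ a b : Λ, a * b ≠ b * a := by
    obtain ⟨a, b, h⟩ := hab
    refine ⟨φ a, φ b, fun h' => h (φ.injective ?_)⟩
    rw [map_mul, map_mul]
    exact h'
  have hE := isIdRigid_EA_mapsTo_pslQuotient_of_isFreeOrSurface_hfinFree Λ hΓ habΛ (hN Λ hΛ)
  have hC45 := cor_4_5_geometric_mapsTo_pslQuotient_of_isFreeOrSurface_hfinFree Λ hΓ habΛ (hN Λ hΛ)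
  rw [hH] at hE hC45
  exact ⟨hE, (AbsTopIII.cor_4_5_full_arch_iff_cor_4_5 _).mpr hC45⟩

/-- **Prop 4.2 (i) id-rigidity and `Cor_4_5_full` at a genuine PUNCTURED `X` from the cusp data of the
Möbius deck group.**  As `isIdRigid_EA_and_cor_4_5_full_mapsTo_of_cover_of_hN`, with `hN` replaced by
(P) «the deck group `Λ̄` of `k` contains the image of a parabolic element of `SL(2, ℝ)`» and (FC) «finitely
many `Λ̄`-classes of cusps» (eigenlines of parabolic lifts, represented by a finite set of vectors) — the
binder shapes of abc-iut-L4-t14's `isIdRigid_EA_mapsTo_pslQuotient_of_cusps_hfinFree` VERBATIM;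
`hN` is then abc-iut-L4-d1's `LocObj.finiteIndex_subgroupOf_normalizer_of_cusps`.
[cite: MochizukiAbsTopIII2015, Proposition 4.2 (i) proof p.106]
[cite: MochizukiAbsTopIII2015, Corollary 4.5 pp.107–109] [cite: FarkasKra1992, IV.5.6] -/
theorem isIdRigid_EA_and_cor_4_5_full_mapsTo_of_cover_of_cusps {k : ℍ → X.carrier}
    (hk : IsCoveringMap k) (dk : MDifferentiable 𝓘(ℂ, ℂ) 𝓘(ℂ, ℂ) k) (x₀ : X.carrier)
    (hπ : IsFreeOrSurface (FundamentalGroup X.carrier x₀))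
    (hab : ∃ a b : FundamentalGroup X.carrier x₀, a * b ≠ b * a)
    (hP : ∀ Λ : Subgroup PSL2R, (∀ q : PSL2R, q ∈ Λ ↔ ∀ τ : ℍ, k (q • τ) = k τ) →
      ∃ t : SL(2, ℝ), QuotientGroup.mk' (Subgroup.center SL(2, ℝ)) t ∈ Λ ∧
        (t : Matrix (Fin 2) (Fin 2) ℝ).IsParabolic)
    (hFC : ∀ Λ : Subgroup PSL2R, (∀ q : PSL2R, q ∈ Λ ↔ ∀ τ : ℍ, k (q • τ) = k τ) →
      ∃ F : Finset (Fin 2 → ℝ), ∀ t : SL(2, ℝ),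
        QuotientGroup.mk' (Subgroup.center SL(2, ℝ)) t ∈ Λ → (t : Matrix (Fin 2) (Fin 2) ℝ).IsParabolic →
        ∀ v : Fin 2 → ℝ, v ≠ 0 → (∃ c : ℝ, (t : Matrix (Fin 2) (Fin 2) ℝ) *ᵥ v = c • v) →
        ∃ g : SL(2, ℝ), QuotientGroup.mk' (Subgroup.center SL(2, ℝ)) g ∈ Λ ∧ ∃ w ∈ F, ∃ c : ℝ,
          (g : Matrix (Fin 2) (Fin 2) ℝ) *ᵥ v = c • w) :
    IsIdRigid (geometricAutHolFieldFunctor fun Y : HolRS => Nonempty (Y ⟶ X)).EA ∧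
      AbsTopIII.Cor_4_5_full
        (archLogFrobeniusData (geometricAutHolFieldFunctor fun Y : HolRS => Nonempty (Y ⟶ X)))
        (archTelecoreData (geometricAutHolFieldFunctor fun Y : HolRS => Nonempty (Y ⟶ X))) := by
  obtain ⟨Λ, hPD, hC, hΛ, hπΛ, -, hH, -⟩ := exists_pslQuotient_iso_of_cover_transport X hk dk
  obtain ⟨φ⟩ := hπΛ x₀
  have hΓ : IsFreeOrSurface Λ := IsFreeOrSurface.of_mulEquiv φ.symm hπ
  have habΛ : ∃ a b : Λ, a * b ≠ b * a := by
    obtain ⟨a, b, h⟩ := hab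
    refine ⟨φ a, φ b, fun h' => h (φ.injective ?_)⟩
    rw [map_mul, map_mul]
    exact h'
  have hE := isIdRigid_EA_mapsTo_pslQuotient_of_cusps_hfinFree Λ hΓ habΛ (hP Λ hΛ) (hFC Λ hΛ)
  have hC45 := cor_4_5_geometric_mapsTo_pslQuotient_of_cusps_hfinFree Λ hΓ habΛ (hP Λ hΛ) (hFC Λ hΛ)
  rw [hH] at hE hC45
  exact ⟨hE, (AbsTopIII.cor_4_5_full_arch_iff_cor_4_5 _).mpr hC45⟩

end Cover

/-! ### §2 No covering given: uniformisation from non-abelian `π₁` -/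

section Uniformised

variable (X : HolRS)

/-- **Prop 4.2 (i) id-rigidity and `Cor_4_5_full` at EVERY connected second-countable Riemann surface whose
fundamental group is free of finite rank or an orientable surface group and non-abelian, from the cusp
data** — no covering given: the holomorphic covering `k : ℍ → X` comes from
`exists_pslQuotient_iso_of_nonabelian_fundamentalGroup_unconditional` (uniformisation of simply connected
Riemann surfaces, a theorem of the tree), so (P) and (FC) are asked of the deck group of EVERY holomorphic
covering `ℍ → X`. [cite: MochizukiAbsTopIII2015, Proposition 4.2 (i) proof p.106]
[cite: MochizukiAbsTopIII2015, Corollary 4.5 pp.107–109] [cite: FarkasKra1992, IV.5.5–IV.5.6] -/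
theorem isIdRigid_EA_and_cor_4_5_full_mapsTo_of_isFreeOrSurface_fundamentalGroup_of_cusps
    [SecondCountableTopology X.carrier] (x₀ : X.carrier)
    (hπ : IsFreeOrSurface (FundamentalGroup X.carrier x₀))
    (hab : ∃ a b : FundamentalGroup X.carrier x₀, a * b ≠ b * a)
    (hP : ∀ k : ℍ → X.carrier, IsCoveringMap k → MDifferentiable 𝓘(ℂ, ℂ) 𝓘(ℂ, ℂ) k →
      ∀ Λ : Subgroup PSL2R, (∀ q : PSL2R, q ∈ Λ ↔ ∀ τ : ℍ, k (q • τ) = k τ) →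
      ∃ t : SL(2, ℝ), QuotientGroup.mk' (Subgroup.center SL(2, ℝ)) t ∈ Λ ∧
        (t : Matrix (Fin 2) (Fin 2) ℝ).IsParabolic)
    (hFC : ∀ k : ℍ → X.carrier, IsCoveringMap k → MDifferentiable 𝓘(ℂ, ℂ) 𝓘(ℂ, ℂ) k →
      ∀ Λ : Subgroup PSL2R, (∀ q : PSL2R, q ∈ Λ ↔ ∀ τ : ℍ, k (q • τ) = k τ) →
      ∃ F : Finset (Fin 2 → ℝ), ∀ t : SL(2, ℝ),
        QuotientGroup.mk' (Subgroup.center SL(2, ℝ)) t ∈ Λ → (t : Matrix (Fin 2) (Fin 2) ℝ).IsParabolic →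
        ∀ v : Fin 2 → ℝ, v ≠ 0 → (∃ c : ℝ, (t : Matrix (Fin 2) (Fin 2) ℝ) *ᵥ v = c • v) →
        ∃ g : SL(2, ℝ), QuotientGroup.mk' (Subgroup.center SL(2, ℝ)) g ∈ Λ ∧ ∃ w ∈ F, ∃ c : ℝ,
          (g : Matrix (Fin 2) (Fin 2) ℝ) *ᵥ v = c • w) :
    IsIdRigid (geometricAutHolFieldFunctor fun Y : HolRS => Nonempty (Y ⟶ X)).EA ∧
      AbsTopIII.Cor_4_5_full
        (archLogFrobeniusData (geometricAutHolFieldFunctor fun Y : HolRS => Nonempty (Y ⟶ X)))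
        (archTelecoreData (geometricAutHolFieldFunctor fun Y : HolRS => Nonempty (Y ⟶ X))) := by
  obtain ⟨k, Λ, hPD, hC, hk, dk, -⟩ :=
    exists_pslQuotient_iso_of_nonabelian_fundamentalGroup_unconditional X x₀ hab
  exact X.isIdRigid_EA_and_cor_4_5_full_mapsTo_of_cover_of_cusps hk dk x₀ hπ hab (hP k hk dk)
    (hFC k hk dk)

/-- **The `hN` form with no covering given**: `π₁(X, x₀)` free-or-surface and non-abelian, and
`[N(Λ̄′) : Λ̄′] < ∞` for every finite-index subgroup of the deck group of every holomorphic covering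
`ℍ → X` (e.g. from a finite-area fundamental domain, abc-iut-L4-d1's
`finiteIndex_subgroupOf_normalizer_of_finite_covolume_of_le'`).
[cite: MochizukiAbsTopIII2015, Proposition 4.2 (i) proof p.106]
[cite: MochizukiAbsTopIII2015, Corollary 4.5 pp.107–109] [cite: FarkasKra1992, IV.5.5–IV.5.6] -/
theorem isIdRigid_EA_and_cor_4_5_full_mapsTo_of_isFreeOrSurface_fundamentalGroup_of_hN
    [SecondCountableTopology X.carrier] (x₀ : X.carrier)
    (hπ : IsFreeOrSurface (FundamentalGroup X.carrier x₀))
    (hab : ∃ a b : FundamentalGroup X.carrier x₀, a * b ≠ b * a)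
    (hN : ∀ k : ℍ → X.carrier, IsCoveringMap k → MDifferentiable 𝓘(ℂ, ℂ) 𝓘(ℂ, ℂ) k →
      ∀ Λ : Subgroup PSL2R, (∀ q : PSL2R, q ∈ Λ ↔ ∀ τ : ℍ, k (q • τ) = k τ) →
      ∀ Λ' : _root_.Literature.AnabelianGeometry.AbsoluteAnabelian.LocObj Λ,
        (Λ'.toSubgroup.subgroupOf (Subgroup.normalizer (Λ'.toSubgroup : Set PSL2R))).FiniteIndex) :
    IsIdRigid (geometricAutHolFieldFunctor fun Y : HolRS => Nonempty (Y ⟶ X)).EA ∧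
      AbsTopIII.Cor_4_5_full
        (archLogFrobeniusData (geometricAutHolFieldFunctor fun Y : HolRS => Nonempty (Y ⟶ X)))
        (archTelecoreData (geometricAutHolFieldFunctor fun Y : HolRS => Nonempty (Y ⟶ X))) := by
  obtain ⟨k, Λ, hPD, hC, hk, dk, -⟩ :=
    exists_pslQuotient_iso_of_nonabelian_fundamentalGroup_unconditional X x₀ hab
  exact X.isIdRigid_EA_and_cor_4_5_full_mapsTo_of_cover_of_hN hk dk x₀ hπ hab (hN k hk dk)

end Uniformised

/-! ### §3 The GENUINE punctured surface `M ∖ S`: (P) discharged -/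

section Punctured

variable {M : Type} [TopologicalSpace M] [T2Space M] [SecondCountableTopology M] [ChartedSpace ℂ M]
  [IsManifold 𝓘(ℂ, ℂ) ω M]

/-- ★ **[AbsTopIII] Prop 4.2 (i) id-rigidity and `Cor_4_5_full` at the GENUINE punctured Riemann surface
`M ∖ S`, over (FC).**  For `M` a second-countable Riemann surface, `S ⊆ M` finite and non-empty with
`M ∖ S` connected, `π₁(M ∖ S, x₀)` free of finite rank or an orientable surface group and non-abelian
(every hyperbolic curve of type `(g, r)`, `r ≥ 1`: `π₁` free of rank `2g + r − 1 ≥ 2`), and (FC)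
«finitely many classes of cusps» for the Möbius deck group of every uniformising covering
`k : ℍ → M ∖ S`: the geometric `EA` of «objects of `HolRS` mapping to `M ∖ S`» is ID-RIGID and Cor 4.5
holds in full.  The cusp EXISTS — hypothesis (P) — by abc-iut-w6-d031's
`exists_parabolic_mem_of_cover_ofOpens_compl_finite` (a puncture is a cusp of every uniformising group),
so (P) is NOT a hypothesis here. [cite: MochizukiAbsTopIII2015, Proposition 4.2 (i) proof p.106]
[cite: MochizukiAbsTopIII2015, Corollary 4.5 pp.107–109] [cite: FarkasKra1992, IV.5.5–IV.5.6] -/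
theorem isIdRigid_EA_and_cor_4_5_full_ofOpens_compl_finite_of_cuspClasses {S : Set M}
    (hS : S.Finite) (hne : S.Nonempty) (hconn : IsConnected (Sᶜ : Set M))
    (x₀ : (ofOpens (⟨Sᶜ, hS.isClosed.isOpen_compl⟩ : Opens M) hconn).carrier)
    (hπ : IsFreeOrSurface
      (FundamentalGroup (ofOpens (⟨Sᶜ, hS.isClosed.isOpen_compl⟩ : Opens M) hconn).carrier x₀))
    (hab : ∃ a b : FundamentalGroup (ofOpens (⟨Sᶜ, hS.isClosed.isOpen_compl⟩ : Opens M) hconn).carrier x₀,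
      a * b ≠ b * a)
    (hFC : ∀ k : ℍ → (ofOpens (⟨Sᶜ, hS.isClosed.isOpen_compl⟩ : Opens M) hconn).carrier,
      IsCoveringMap k → MDifferentiable 𝓘(ℂ, ℂ) 𝓘(ℂ, ℂ) k →
      ∀ Λ : Subgroup PSL2R, (∀ q : PSL2R, q ∈ Λ ↔ ∀ τ : ℍ, k (q • τ) = k τ) →
      ∃ F : Finset (Fin 2 → ℝ), ∀ t : SL(2, ℝ),
        QuotientGroup.mk' (Subgroup.center SL(2, ℝ)) t ∈ Λ → (t : Matrix (Fin 2) (Fin 2) ℝ).IsParabolic →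
        ∀ v : Fin 2 → ℝ, v ≠ 0 → (∃ c : ℝ, (t : Matrix (Fin 2) (Fin 2) ℝ) *ᵥ v = c • v) →
        ∃ g : SL(2, ℝ), QuotientGroup.mk' (Subgroup.center SL(2, ℝ)) g ∈ Λ ∧ ∃ w ∈ F, ∃ c : ℝ,
          (g : Matrix (Fin 2) (Fin 2) ℝ) *ᵥ v = c • w) :
    IsIdRigid (geometricAutHolFieldFunctor fun Y : HolRS =>
        Nonempty (Y ⟶ ofOpens (⟨Sᶜ, hS.isClosed.isOpen_compl⟩ : Opens M) hconn)).EA ∧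
      AbsTopIII.Cor_4_5_full
        (archLogFrobeniusData (geometricAutHolFieldFunctor fun Y : HolRS =>
          Nonempty (Y ⟶ ofOpens (⟨Sᶜ, hS.isClosed.isOpen_compl⟩ : Opens M) hconn)))
        (archTelecoreData (geometricAutHolFieldFunctor fun Y : HolRS =>
          Nonempty (Y ⟶ ofOpens (⟨Sᶜ, hS.isClosed.isOpen_compl⟩ : Opens M) hconn))) := by
  haveI : SecondCountableTopology
      (ofOpens (⟨Sᶜ, hS.isClosed.isOpen_compl⟩ : Opens M) hconn).carrier := by
    change SecondCountableTopology ((⟨Sᶜ, hS.isClosed.isOpen_compl⟩ : Opens M) : Type)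
    infer_instance
  obtain ⟨k, Λ₀, hPD₀, hC₀, hk, dk, -⟩ :=
    exists_pslQuotient_iso_of_nonabelian_fundamentalGroup_unconditional _ x₀ hab
  refine (ofOpens (⟨Sᶜ, hS.isClosed.isOpen_compl⟩ : Opens M)
    hconn).isIdRigid_EA_and_cor_4_5_full_mapsTo_of_cover_of_cusps hk dk x₀ hπ hab ?_ (hFC k hk dk)
  -- (P): a puncture is a cusp of the deck group (abc-iut-w6-d031)
  intro Λ hΛ
  -- the deck group acts freely (it is determined by the membership criterion; freeness from the junction)
  obtain ⟨Λ₁, hPD₁, hC₁, hΛ₁, -⟩ := exists_pslQuotient_iso_of_cover_transport _ hk dk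
  have hΛeq : Λ = Λ₁ := by
    ext q
    rw [hΛ q, hΛ₁ q]
  subst hΛeq
  exact exists_parabolic_mem_of_cover_ofOpens_compl_finite hS hne hconn hk dk Λ hΛ

end Punctured

/-! ### §4 Every NON-COMPACT Riemann surface of finite type (the `IsOfFiniteType` vocabulary of Cor 2.4) -/

section FiniteType

variable (X : HolRS)

/-- **(P) at every NON-COMPACT Riemann surface of finite type**: if `X ∈ HolRS` is of finite type
(`IsOfFiniteType`: a biholomorphism `e : X ≅ X̄ ∖ S` onto a compact surface minus a finite set) and not
compact, then for EVERY holomorphic covering `k : ℍ → X` whose Möbius deck group `Λ̄` (membership criterion)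
acts freely, `Λ̄` contains the image of a PARABOLIC element of `SL(2, ℝ)`.  Reduction to abc-iut-w6-d031's
`exists_parabolic_mem_of_cover_ofOpens_compl_finite` at the genuine `X̄ ∖ S`: `S ≠ ∅` because `X` is not
compact, `X̄ ∖ S` is connected as the image of `X`, and `e ∘ k` is a holomorphic covering of `X̄ ∖ S` with
the SAME deck group (`e` is injective). [cite: MochizukiAbsTopIII2015, Proposition 4.2 (i) proof p.106]
[cite: FarkasKra1992, IV.5.5–IV.5.6] -/
theorem exists_parabolic_mem_of_cover_of_isOfFiniteType (hX : IsOfFiniteType X.carrier)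
    (hnc : ¬ CompactSpace X.carrier) {k : ℍ → X.carrier} (hk : IsCoveringMap k)
    (dk : MDifferentiable 𝓘(ℂ, ℂ) 𝓘(ℂ, ℂ) k) (Λ : Subgroup PSL2R) [IsCancelSMul Λ ℍ]
    (hΛ : ∀ q : PSL2R, q ∈ Λ ↔ ∀ τ : ℍ, k (q • τ) = k τ) :
    ∃ t : SL(2, ℝ), (QuotientGroup.mk' (Subgroup.center SL(2, ℝ)) t : PSL2R) ∈ Λ ∧
      (t : Matrix (Fin 2) (Fin 2) ℝ).IsParabolic := by
  -- unpack the finite-type witness `e : X ≅ X̄ ∖ S`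
  obtain ⟨⟨Xc, S, e, hol, -⟩⟩ := hX
  -- `S ≠ ∅` since `X` is not compact
  have hne : ((S : Set Xc)).Nonempty := by
    rw [Finset.coe_nonempty]
    by_contra h
    rw [Finset.not_nonempty_iff_eq_empty] at h
    subst h
    apply hnc
    haveI : CompactSpace
        ((⟨(((∅ : Finset Xc) : Set Xc))ᶜ, (∅ : Finset Xc).finite_toSet.isClosed.isOpen_compl⟩ :
          Opens Xc) : Type) := by
      refine isCompact_iff_compactSpace.mp ?_
      change IsCompact ((((∅ : Finset Xc) : Set Xc))ᶜ)
      rw [Finset.coe_empty, Set.compl_empty]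
      exact isCompact_univ
    exact e.symm.compactSpace
  -- `X̄ ∖ S` is connected (continuous image of the connected `X`)
  have hconn : IsConnected (((S : Set Xc))ᶜ) := by
    have hr : Set.range (Subtype.val ∘ e) = ((S : Set Xc))ᶜ := by
      rw [e.surjective.range_comp]
      exact Subtype.range_coe
    rw [← hr]
    exact isConnected_range (continuous_subtype_val.comp e.continuous)
  -- the transported covering `e ∘ k : ℍ → X̄ ∖ S` has the same Möbius deck group
  have hk' : IsCoveringMap (e ∘ k) := hk.homeomorph_comp e
  have dk' : MDifferentiable 𝓘(ℂ, ℂ) 𝓘(ℂ, ℂ) (e ∘ k) := hol.comp dk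
  have hΛ' : ∀ q : PSL2R, q ∈ Λ ↔ ∀ τ : ℍ, (e ∘ k) (q • τ) = (e ∘ k) τ := by
    intro q
    rw [hΛ q]
    simp only [Function.comp_apply, EmbeddingLike.apply_eq_iff_eq]
  -- (P) at the genuine punctured surface `X̄ ∖ S` (abc-iut-w6-d031)
  exact exists_parabolic_mem_of_cover_ofOpens_compl_finite (M := Xc) S.finite_toSet hne hconn hk' dk' Λ
    hΛ'

/-- ★★ **[AbsTopIII] Prop 4.2 (i) id-rigidity and `Cor_4_5_full` at EVERY non-compact connected
second-countable Riemann surface OF FINITE TYPE (`IsOfFiniteType`: biholomorphic to a compact surface minus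
finitely many points — the standing hypothesis of [AbsTopIII] Cor 2.4) whose fundamental group is free of
finite rank or an orientable surface group and non-abelian, over (FC) for the Möbius deck group of every
uniformising covering.**  (P) is discharged by `exists_parabolic_mem_of_cover_of_isOfFiniteType`.
[cite: MochizukiAbsTopIII2015, Proposition 4.2 (i) proof p.106]
[cite: MochizukiAbsTopIII2015, Corollary 4.5 pp.107–109] [cite: FarkasKra1992, IV.5.5–IV.5.6] -/
theorem isIdRigid_EA_and_cor_4_5_full_mapsTo_of_isOfFiniteType_of_cuspClasses
    [SecondCountableTopology X.carrier] (hX : IsOfFiniteType X.carrier) (hnc : ¬ CompactSpace X.carrier)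
    (x₀ : X.carrier) (hπ : IsFreeOrSurface (FundamentalGroup X.carrier x₀))
    (hab : ∃ a b : FundamentalGroup X.carrier x₀, a * b ≠ b * a)
    (hFC : ∀ k : ℍ → X.carrier, IsCoveringMap k → MDifferentiable 𝓘(ℂ, ℂ) 𝓘(ℂ, ℂ) k →
      ∀ Λ : Subgroup PSL2R, (∀ q : PSL2R, q ∈ Λ ↔ ∀ τ : ℍ, k (q • τ) = k τ) →
      ∃ F : Finset (Fin 2 → ℝ), ∀ t : SL(2, ℝ),
        QuotientGroup.mk' (Subgroup.center SL(2, ℝ)) t ∈ Λ → (t : Matrix (Fin 2) (Fin 2) ℝ).IsParabolic →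
        ∀ v : Fin 2 → ℝ, v ≠ 0 → (∃ c : ℝ, (t : Matrix (Fin 2) (Fin 2) ℝ) *ᵥ v = c • v) →
        ∃ g : SL(2, ℝ), QuotientGroup.mk' (Subgroup.center SL(2, ℝ)) g ∈ Λ ∧ ∃ w ∈ F, ∃ c : ℝ,
          (g : Matrix (Fin 2) (Fin 2) ℝ) *ᵥ v = c • w) :
    IsIdRigid (geometricAutHolFieldFunctor fun Y : HolRS => Nonempty (Y ⟶ X)).EA ∧
      AbsTopIII.Cor_4_5_full
        (archLogFrobeniusData (geometricAutHolFieldFunctor fun Y : HolRS => Nonempty (Y ⟶ X)))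
        (archTelecoreData (geometricAutHolFieldFunctor fun Y : HolRS => Nonempty (Y ⟶ X))) := by
  obtain ⟨k, Λ₀, hPD₀, hC₀, hk, dk, -⟩ :=
    exists_pslQuotient_iso_of_nonabelian_fundamentalGroup_unconditional X x₀ hab
  refine X.isIdRigid_EA_and_cor_4_5_full_mapsTo_of_cover_of_cusps hk dk x₀ hπ hab ?_ (hFC k hk dk)
  intro Λ hΛ
  -- the deck group acts freely (from the junction; it is determined by the membership criterion)
  obtain ⟨Λ₁, hPD₁, hC₁, hΛ₁, -⟩ := exists_pslQuotient_iso_of_cover_transport X hk dk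
  have hΛeq : Λ = Λ₁ := by
    ext q
    rw [hΛ q, hΛ₁ q]
  subst hΛeq
  exact X.exists_parabolic_mem_of_cover_of_isOfFiniteType hX hnc hk dk Λ hΛ

end FiniteType


end HolRS

end Literature.AnabelianGeometry.AbsoluteAnabelian

end
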